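import Mathlib
import Literature.MathematicalPhysics.QuantumLattice.GrassmannCoefficientIntegral
import Literature.MathematicalPhysics.QuantumLattice.GrassmannLinearSubstitution
import Literature.MathematicalPhysics.QuantumLattice.GrassmannParity
import Literature.MathematicalPhysics.QuantumLattice.FermionOperatorsProofs
import HarnessLib

/-!
# Pair calculus in the fermionic Grassmann algebra `Λ[ψ̄_i, ψ_i]`
# (Berezin 1966, Ch. I §3; Salmhofer–Seiler, CMP 139 (1991), §2 (2.19)–(2.20))

The commuting, square-zero pairs `ψ̄_i ψ_i` of the Grassmann algebra on generators `ψ̄_i, ψ_i`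
(`i ∈ ι`, the tree's `GrassmannAlgebra ℂ (ι ⊕ₗ ι)` with `psiBar`, `psi`, `quadratic`, `grassmannExp`,
`berezin` of `GrassmannIntegral.lean`) carry the combinatorics of strongly coupled lattice gauge
theory with staggered fermions (Salmhofer–Seiler §2): the meson field `ψ̄ψ(x) = ∑_a ψ̄_a(x)ψ_a(x)`
(2.6) is a sum of pairs, `e^{m ψ̄ψ(x)}` and `(ψ̄ψ(x))^k` expand over products of distinct pairs, and the
Berezin integral sees only the full product ("the rule that `∏_x (ψ̄ψ(x))^N` must appear in each
term", p. 401, (2.20)).  This file proves that calculus once, for an arbitrary finite linearly ordered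
index type `ι` (colour × site in the applications):

* `pair i j = ψ̄_i ψ_j`; `pairProd T = ∏_{i ∈ T} ψ̄_i ψ_i` (a product of commuting elements,
  `Finset.noncommProd`); `pairProd_mul_pairProd`: `∏_T · ∏_{T'} = [T ∩ T' = ∅] ∏_{T ∪ T'}`;
* `grassmannBasis_dbl`: the basis monomial on the doubled set `dbl T = {ψ̄_i, ψ_i : i ∈ T}` is
  `θ_{dbl T} = ψ̄_{i₁}⋯ψ̄_{i_k} ψ_{i₁}⋯ψ_{i_k} = ε_k ∏_a ψ̄_{i_a}ψ_{i_a}`, `ε_k = (-1)^{k(k-1)/2}` (`sgn k`)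
  (Berezin (3.3): reordering sign);
* `grassmannExp_smul_sum_pair`: `exp(m ∑_{i∈S} ψ̄_iψ_i) = ∑_{T ⊆ S} m^{|T|} ∏_{i∈T} ψ̄_iψ_i`;
  `sum_pair_pow`: `(∑_{i∈S} ψ̄_iψ_i)^k = k! ∑_{T ⊆ S, |T|=k} ∏_{i∈T} ψ̄_iψ_i`, hence
  `sum_pair_pow_eq_zero`: `(∑_{i∈S} ψ̄_iψ_i)^k = 0` for `k > |S|` (Salmhofer–Seiler p. 401:
  "`(ψ̄ψ(x))^n = 0` for `n > N` by nilpotency");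
* `berezin_pairProd`: `∫dψ̄dψ ∏_{i∈T} ψ̄_iψ_i = ε_{|ι|} [T = ι]` (Berezin (3.4)–(3.5));
* the substitutions used for symmetry arguments: `scale c` (`ψ̄_i ↦ c(ψ̄_i)ψ̄_i, ψ_i ↦ c(ψ_i)ψ_i`,
  the tree's `ExteriorAlgebra.map (LinearMap.mulLeft ℂ c)`) and `relabel τ` (`ψ̄_i ↦ ψ̄_{τ i}`,
  `ψ_i ↦ ψ_{τ i}`, the tree's `ExteriorAlgebra.map (LinearMap.funLeft ℂ ℂ _)`), with their action on
  pairs, pair products, doubled monomials and exponentials;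
* elementary facts on `quadratic ℂ A = ψ̄Aψ`: additivity, homogeneity, centrality, nilpotency of
  `c • ψ̄Aψ`, evenness and centrality of `exp(c • ψ̄Aψ)`.

Everything here is proved; no named fact is introduced.  Used by `RossiWolffOneLinkIntegral.lean`
(the one-link integral (2.16)–(2.17)) and the `β = 0` bosonisation (2.19)–(2.24).

## Sources

F. A. Berezin, *The Method of Second Quantization* (Academic Press 1966), Ch. I §3, (3.1)–(3.5)
[`Berezin1966`]; M. Salmhofer, E. Seiler, *Proof of chiral symmetry breaking in strongly coupled
lattice gauge theory*, Commun. Math. Phys. 139 (1991) 395–432, §2 (2.6), (2.19)–(2.20), p. 401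
[`SalmhoferSeiler1991`].
-/

noncomputable section

namespace Literature.MathematicalPhysics.QuantumLattice

namespace GrassmannAlgebra

open Matrix

section PairAlgebra

variable {ι : Type*} [LinearOrder ι]

/-! ### Pairs -/

/-- The pair `ψ̄_i ψ_j`. [cite: Berezin1966, Ch. I §3 (3.1)] -/
abbrev pair (i j : ι) : GrassmannAlgebra ℂ (ι ⊕ₗ ι) := psiBar ℂ i * psi ℂ j

/-- Pairs are central. [cite: Berezin1966, Ch. I §3 (3.1)] -/
theorem commute_pair (i j : ι) (z : GrassmannAlgebra ℂ (ι ⊕ₗ ι)) : Commute (pair i j) z :=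
  commute_psiBar_mul_psi ℂ i j z

/-- Pairs square to zero: `(ψ̄_iψ_i)² = 0`. [cite: Berezin1966, Ch. I §3 (3.1)] -/
theorem pair_mul_self (i : ι) : pair i i * pair i i = 0 :=
  psiBar_mul_psi_mul_psiBar_mul_psi_self ℂ i i i

/-- Index of the generator `ψ̄_i`. [cite: Berezin1966, Ch. I §3] -/
abbrev barIdx (i : ι) : ι ⊕ₗ ι := toLex (Sum.inl i)
/-- Index of the generator `ψ_i`. [cite: Berezin1966, Ch. I §3] -/
abbrev psiIdx (i : ι) : ι ⊕ₗ ι := toLex (Sum.inr i)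

omit [LinearOrder ι] in
/-- `ψ̄`-indices and `ψ`-indices are distinct. [cite: Berezin1966, Ch. I §3] -/
theorem barIdx_ne_psiIdx (i j : ι) : (barIdx i : ι ⊕ₗ ι) ≠ psiIdx j := by
  simp [barIdx, psiIdx]

/-- The same weight on `ψ̄_i` and on `ψ_i`. [cite: Berezin1966, Ch. I §3] -/
def dblWeight (t : ι → ℂ) : ι ⊕ₗ ι → ℂ := fun w => Sum.elim t t (ofLex w)

omit [LinearOrder ι] in
/-- The doubled weight on `ψ̄_i`. [cite: Berezin1966, Ch. I §3] -/
@[simp] theorem dblWeight_barIdx (t : ι → ℂ) (i : ι) : dblWeight t (barIdx i) = t i := rfl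
omit [LinearOrder ι] in
/-- The doubled weight on `ψ_i`. [cite: Berezin1966, Ch. I §3] -/
@[simp] theorem dblWeight_psiIdx (t : ι → ℂ) (i : ι) : dblWeight t (psiIdx i) = t i := rfl

/-! ### Doubled index sets -/

/-- The set of generators `{ψ̄_i, ψ_i : i ∈ T}`. [cite: Berezin1966, Ch. I §3 (3.3)] -/
def dbl (T : Finset ι) : Finset (ι ⊕ₗ ι) := (T.disjSum T).map toLex.toEmbedding

omit [LinearOrder ι] in
/-- `ψ̄_i ∈ dbl T ↔ i ∈ T`. [cite: Berezin1966, Ch. I §3 (3.3)] -/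
@[simp] theorem barIdx_mem_dbl {T : Finset ι} {i : ι} : barIdx i ∈ dbl T ↔ i ∈ T := by
  simp [dbl, barIdx]

omit [LinearOrder ι] in
/-- `ψ_i ∈ dbl T ↔ i ∈ T`. [cite: Berezin1966, Ch. I §3 (3.3)] -/
@[simp] theorem psiIdx_mem_dbl {T : Finset ι} {i : ι} : psiIdx i ∈ dbl T ↔ i ∈ T := by
  simp [dbl, psiIdx]

omit [LinearOrder ι] in
/-- Membership in a doubled set. [cite: Berezin1966, Ch. I §3 (3.3)] -/
theorem mem_dbl {T : Finset ι} {w : ι ⊕ₗ ι} : w ∈ dbl T ↔ Sum.elim (· ∈ T) (· ∈ T) (ofLex w) := by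
  obtain ⟨w, rfl⟩ := toLex.surjective w
  rcases w with i | i
  · exact barIdx_mem_dbl
  · exact psiIdx_mem_dbl

omit [LinearOrder ι] in
/-- A doubled set has twice as many elements. [cite: Berezin1966, Ch. I §3 (3.3)] -/
theorem card_dbl (T : Finset ι) : (dbl T).card = T.card + T.card := by
  rw [dbl, Finset.card_map, Finset.card_disjSum]

omit [LinearOrder ι] in
/-- Doubling is injective. [cite: Berezin1966, Ch. I §3 (3.3)] -/
theorem dbl_injective : Function.Injective (dbl : Finset ι → Finset (ι ⊕ₗ ι)) := by
  intro T T' h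
  ext i
  rw [← barIdx_mem_dbl, h, barIdx_mem_dbl]

/-- A set of generators is *doubled* when it contains `ψ̄_i` iff it contains `ψ_i`. [cite: Berezin1966, Ch. I §3 (3.3)] -/
def IsDoubled (s : Finset (ι ⊕ₗ ι)) : Prop := ∀ i, barIdx i ∈ s ↔ psiIdx i ∈ s

omit [LinearOrder ι] in
/-- `dbl T` is doubled. [cite: Berezin1966, Ch. I §3 (3.3)] -/
theorem isDoubled_dbl (T : Finset ι) : IsDoubled (dbl T) := fun i => by simp

omit [LinearOrder ι] in
/-- Products over a doubled set. [cite: Berezin1966, Ch. I §3 (3.3)] -/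
theorem prod_dbl {M : Type*} [CommMonoid M] (T : Finset ι) (f : ι ⊕ₗ ι → M) :
    ∏ w ∈ dbl T, f w = ∏ i ∈ T, (f (barIdx i) * f (psiIdx i)) := by
  rw [dbl, Finset.prod_map, Finset.prod_disjSum, Finset.prod_mul_distrib]
  rfl

/-! ### Products of pairs -/

/-- The pairs `ψ̄_iψ_i` pairwise commute. [cite: Berezin1966, Ch. I §3 (3.1)] -/
theorem pairwise_commute_pair (T : Finset ι) :
    (T : Set ι).Pairwise (Function.onFun Commute fun i : ι => pair i i) :=
  fun i _ j _ _ => commute_pair i i (pair j j)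

/-- The product `∏_{i ∈ T} ψ̄_i ψ_i` of the (commuting) pairs over `T`. [cite: SalmhoferSeiler1991, §2 (2.20)] -/
def pairProd (T : Finset ι) : GrassmannAlgebra ℂ (ι ⊕ₗ ι) :=
  T.noncommProd (fun i => pair i i) (pairwise_commute_pair T)

/-- The pair product as an ordered list product. [cite: SalmhoferSeiler1991, §2 (2.20)] -/
theorem pairProd_eq_list_prod (T : Finset ι) :
    pairProd T = ((T.sort (· ≤ ·)).map fun i => pair i i).prod := by
  have h := Finset.noncommProd_toFinset (T.sort (· ≤ ·)) (fun i : ι => pair i i)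
    (by rw [Finset.sort_toFinset]; exact pairwise_commute_pair T) (Finset.sort_nodup _ _)
  rw [← h]
  unfold pairProd
  congr 1
  exact (Finset.sort_toFinset _ _).symm

/-- The empty pair product is `1`. [cite: SalmhoferSeiler1991, §2 (2.20)] -/
@[simp] theorem pairProd_empty : pairProd (∅ : Finset ι) = 1 := Finset.noncommProd_empty _ _

/-- `∏_{insert a T} = ψ̄_aψ_a ∏_T`. [cite: SalmhoferSeiler1991, §2 (2.20)] -/
theorem pairProd_insert {a : ι} {T : Finset ι} (ha : a ∉ T) :
    pairProd (insert a T) = pair a a * pairProd T :=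
  Finset.noncommProd_insert_of_notMem _ _ _ _ ha

/-- A one-pair product. [cite: SalmhoferSeiler1991, §2 (2.20)] -/
@[simp] theorem pairProd_singleton (a : ι) : pairProd ({a} : Finset ι) = pair a a := by
  rw [← Finset.insert_empty, pairProd_insert (Finset.notMem_empty a), pairProd_empty, mul_one]

/-- Pair products are central. [cite: Berezin1966, Ch. I §3 (3.1)] -/
theorem commute_pairProd (T : Finset ι) (z : GrassmannAlgebra ℂ (ι ⊕ₗ ι)) : Commute (pairProd T) z := by
  induction T using Finset.induction_on with
  | empty => rw [pairProd_empty]; exact Commute.one_left z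
  | insert a T ha ih => rw [pairProd_insert ha]; exact (commute_pair a a z).mul_left ih

/-- Splitting off one pair. [cite: SalmhoferSeiler1991, §2 (2.20)] -/
theorem pairProd_eq_erase_mul {i : ι} {T : Finset ι} (hi : i ∈ T) :
    pairProd T = pairProd (T.erase i) * pair i i := by
  rw [pairProd, pairProd, ← Finset.noncommProd_erase_mul _ hi]

/-- A repeated pair kills the product. [cite: Berezin1966, Ch. I §3 (3.1)] -/
theorem pairProd_mul_pair_of_mem {i : ι} {T : Finset ι} (hi : i ∈ T) : pairProd T * pair i i = 0 := by
  rw [pairProd_eq_erase_mul hi, mul_assoc, pair_mul_self, mul_zero]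

/-- A repeated pair kills the product. [cite: Berezin1966, Ch. I §3 (3.1)] -/
theorem pair_mul_pairProd_of_mem {i : ι} {T : Finset ι} (hi : i ∈ T) : pair i i * pairProd T = 0 := by
  rw [(commute_pair i i _).eq, pairProd_mul_pair_of_mem hi]

/-- `∏_T ∏_{T'} = ∏_{T ∪ T'}` for disjoint index sets, and `0` otherwise (a repeated pair squares
to zero). [cite: SalmhoferSeiler1991, §2 (2.20)] -/
theorem pairProd_mul_pairProd (T T' : Finset ι) :
    pairProd T * pairProd T' = if Disjoint T T' then pairProd (T ∪ T') else 0 := by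
  split_ifs with h
  · rw [pairProd, pairProd, pairProd, Finset.noncommProd_union_of_disjoint h]
  · obtain ⟨i, hi, hi'⟩ := Finset.not_disjoint_iff.1 h
    rw [pairProd_eq_erase_mul hi, mul_assoc, pair_mul_pairProd_of_mem hi', mul_zero]

/-- Pair products over disjoint index sets multiply. [cite: SalmhoferSeiler1991, §2 (2.20)] -/
theorem pairProd_union {T T' : Finset ι} (h : Disjoint T T') :
    pairProd (T ∪ T') = pairProd T * pairProd T' := by
  rw [pairProd_mul_pairProd, if_pos h]

/-- Multiplying a pair product by one more pair. [cite: SalmhoferSeiler1991, §2 (2.20)] -/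
theorem pairProd_mul_pair (T : Finset ι) (i : ι) :
    pairProd T * pair i i = if i ∈ T then 0 else pairProd (insert i T) := by
  split_ifs with hi
  · exact pairProd_mul_pair_of_mem hi
  · rw [pairProd_insert hi, (commute_pair i i _).eq]

/-- Pair products over a family of pairwise disjoint index sets multiply to the pair product over the
union. [cite: SalmhoferSeiler1991, §2 (2.20)] -/
theorem noncommProd_pairProd {α : Type*} [DecidableEq α] (s : Finset α) (T : α → Finset ι)
    (hT : (s : Set α).PairwiseDisjoint T) :
    s.noncommProd (fun x => pairProd (T x)) (fun x _ y _ _ => commute_pairProd (T x) (pairProd (T y))) =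
      pairProd (s.disjiUnion T hT) := by
  induction s using Finset.induction_on with
  | empty => simp
  | insert a s ha ih =>
    have hT' : (s : Set α).PairwiseDisjoint T := hT.subset (by simp)
    rw [Finset.noncommProd_insert_of_notMem _ _ _ _ ha, ih hT']
    have hd : Disjoint (T a) (s.disjiUnion T hT') := by
      rw [Finset.disjoint_disjiUnion_right]
      intro b hb
      exact hT (Finset.mem_insert_self a s) (Finset.mem_insert_of_mem hb) (fun h => ha (h ▸ hb))
    rw [← pairProd_union hd]
    congr 1
    ext i
    simp

/-- Products of scaled pairs. [cite: SalmhoferSeiler1991, §2 (2.19)–(2.20)] -/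
theorem noncommProd_smul_pair (m : ℂ) (T : Finset ι) :
    T.noncommProd (fun i => m • pair i i)
        (fun i _ j _ _ => ((commute_pair i i (pair j j)).smul_left m).smul_right m) =
      m ^ T.card • pairProd T := by
  induction T using Finset.induction_on with
  | empty => simp
  | insert a T ha ih =>
    rw [Finset.noncommProd_insert_of_notMem _ _ _ _ ha, ih, pairProd_insert ha,
      Finset.card_insert_of_notMem ha, pow_succ, smul_mul_smul_comm, mul_comm (m ^ T.card)]

/-- **`exp(m ∑_{i ∈ S} ψ̄_i ψ_i) = ∑_{T ⊆ S} m^{|T|} ∏_{i∈T} ψ̄_i ψ_i`** (the pairs commute and square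
to zero, so `e^{m ψ̄_iψ_i} = 1 + m ψ̄_iψ_i`). [cite: SalmhoferSeiler1991, §2 (2.19)–(2.20)] -/
theorem grassmannExp_smul_sum_pair (m : ℂ) (S : Finset ι) :
    grassmannExp (m • ∑ i ∈ S, pair i i) = ∑ T ∈ S.powerset, m ^ T.card • pairProd T := by
  rw [grassmannExp, Finset.smul_sum,
    exp_sum_eq_sum_noncommProd (fun i => m • pair i i) (fun i z => (commute_pair i i z).smul_left m)
      (fun i => by rw [smul_mul_smul_comm, pair_mul_self, smul_zero]) S]
  exact Finset.sum_congr rfl fun T _ => noncommProd_smul_pair m T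

/-- **Powers of a sum of pairs**: `(∑_{i∈S} ψ̄_iψ_i)^k = k! ∑_{T ⊆ S, |T| = k} ∏_{i∈T} ψ̄_iψ_i`. [cite: SalmhoferSeiler1991, §2 (2.20)] -/
theorem sum_pair_pow (S : Finset ι) (k : ℕ) :
    (∑ i ∈ S, pair i i) ^ k = (k.factorial : ℂ) • ∑ T ∈ S.powersetCard k, pairProd T := by
  induction k with
  | zero => simp [Finset.powersetCard_zero]
  | succ k ih =>
    rw [pow_succ, ih, smul_mul_assoc, Finset.sum_mul]
    have h : ∀ T ∈ S.powersetCard k,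
        pairProd T * ∑ i ∈ S, pair i i = ∑ i ∈ S \ T, pairProd (insert i T) := by
      intro T hT
      have hTS : T ⊆ S := (Finset.mem_powersetCard.1 hT).1
      rw [Finset.mul_sum, ← Finset.sum_sdiff hTS]
      have h1 : ∑ i ∈ S \ T, pairProd T * pair i i = ∑ i ∈ S \ T, pairProd (insert i T) :=
        Finset.sum_congr rfl fun i hi => by rw [pairProd_mul_pair, if_neg (Finset.mem_sdiff.1 hi).2]
      have h2 : ∑ i ∈ T, pairProd T * pair i i = 0 :=
        Finset.sum_eq_zero fun i hi => by rw [pairProd_mul_pair, if_pos hi]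
      rw [h1, h2, add_zero]
    rw [Finset.sum_congr rfl h, sum_powersetCard_sum_insert, ← Nat.cast_smul_eq_nsmul ℂ (k + 1),
      smul_smul, Nat.factorial_succ, Nat.cast_mul, mul_comm ((k + 1 : ℕ) : ℂ)]

/-- **Nilpotency of a sum of pairs**: `(∑_{i∈S} ψ̄_iψ_i)^k = 0` for `k > |S|` (Salmhofer–Seiler
p. 401: `(ψ̄ψ(x))^n = 0` for `n > N`). [cite: SalmhoferSeiler1991, §2 (2.20)] -/
theorem sum_pair_pow_eq_zero {S : Finset ι} {k : ℕ} (hk : S.card < k) : (∑ i ∈ S, pair i i) ^ k = 0 := by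
  rw [sum_pair_pow, Finset.powersetCard_eq_empty.2 hk, Finset.sum_empty, smul_zero]

/-! ### The reordering sign and doubled monomials -/

/-- The orientation sign `ε_n = (-1)^{n(n-1)/2}`. [cite: Berezin1966, Ch. I §3 (3.5)] -/
def sgn (n : ℕ) : ℂ := (-1 : ℂ) ^ (n * (n - 1) / 2)

/-- `ε_n² = 1`. [cite: Berezin1966, Ch. I §3 (3.5)] -/
theorem sgn_mul_self (n : ℕ) : sgn n * sgn n = 1 := by
  rw [sgn, ← pow_add, ← two_mul, pow_mul, neg_one_sq, one_pow]

/-- `ε_n ≠ 0`. [cite: Berezin1966, Ch. I §3 (3.5)] -/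
theorem sgn_ne_zero (n : ℕ) : sgn n ≠ 0 := fun h => by simpa [h] using sgn_mul_self n

/-- `ε_n = (-1)^{n(n-1)/2}`. [cite: Berezin1966, Ch. I §3 (3.5)] -/
theorem sgn_eq (n : ℕ) : sgn n = (-1 : ℂ) ^ (n * (n - 1) / 2) := rfl

/-- Splitting a product over `Fin (k + k)` into its two halves. [cite: Berezin1966, Ch. I §3 (3.3)] -/
theorem prod_ofFn_add_eq {M : Type*} [Monoid M] {k : ℕ} (g : Fin (k + k) → M) :
    (List.ofFn g).prod = (List.ofFn fun i : Fin k => g (finSumFinEquiv (Sum.inl i))).prod *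
      (List.ofFn fun i : Fin k => g (finSumFinEquiv (Sum.inr i))).prod := by
  rw [List.ofFn_add, List.prod_append]
  rfl

/-- The increasing enumeration of a finite set as `List.ofFn`. [cite: Berezin1966, Ch. I §3 (3.3)] -/
theorem sort_eq_ofFn_orderEmbOfFin (T : Finset ι) :
    T.sort (· ≤ ·) = List.ofFn (T.orderEmbOfFin rfl) := by
  rw [List.ofFn_eq_map, Finset.listMap_orderEmbOfFin_finRange]

end PairAlgebra

section Doubled

variable {ι : Type*} [LinearOrder ι] [Fintype ι]

/-- The `ψ̄`-letters of a set of generators. [cite: Berezin1966, Ch. I §3 (3.3)] -/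
def barPart (s : Finset (ι ⊕ₗ ι)) : Finset ι := Finset.univ.filter fun i => barIdx i ∈ s

/-- A doubled set is the doubling of its `ψ̄`-letters. [cite: Berezin1966, Ch. I §3 (3.3)] -/
theorem dbl_barPart {s : Finset (ι ⊕ₗ ι)} (hs : IsDoubled s) : dbl (barPart s) = s := by
  ext w
  obtain ⟨w, rfl⟩ := toLex.surjective w
  rcases w with i | i
  · change barIdx i ∈ _ ↔ barIdx i ∈ s
    simp [barPart]
  · change psiIdx i ∈ _ ↔ psiIdx i ∈ s
    simp [barPart, hs i]

omit [LinearOrder ι] in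
/-- Doubling everything gives everything. [cite: Berezin1966, Ch. I §3 (3.3)] -/
theorem dbl_univ : dbl (Finset.univ : Finset ι) = Finset.univ := by
  ext w; simp [mem_dbl]

omit [LinearOrder ι] in
/-- Only the full set doubles to the full set. [cite: Berezin1966, Ch. I §3 (3.3)] -/
theorem dbl_eq_univ_iff {T : Finset ι} : dbl T = Finset.univ ↔ T = Finset.univ := by
  rw [← dbl_univ]; exact dbl_injective.eq_iff

/-- **The doubled monomial is `ε_k` times the product of pairs**:
`θ_{dbl T} = ψ̄_{i₁}⋯ψ̄_{i_k} ψ_{i₁}⋯ψ_{i_k} = (-1)^{k(k-1)/2} ∏ₐ ψ̄_{iₐ}ψ_{iₐ}`. [cite: Berezin1966, Ch. I §3 (3.3)] -/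
theorem grassmannBasis_dbl (T : Finset ι) :
    grassmannBasis ℂ (ι ⊕ₗ ι) (dbl T) = ((-1 : ℂ) ^ (T.card * (T.card - 1) / 2)) • pairProd T := by
  let e : Fin T.card ↪o ι := T.orderEmbOfFin rfl
  let E : Fin (T.card + T.card) → ι ⊕ₗ ι := fun p => toLex (Sum.map e e (finSumFinEquiv.symm p))
  have hE : StrictMono E := strictMono_toLex_sumMap_finSumFinEquiv_symm e.strictMono
  have hEmem : ∀ p, E p ∈ dbl T := by
    intro p
    obtain ⟨q, rfl⟩ := finSumFinEquiv.surjective p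
    rcases q with i | i
    · simp only [E, Equiv.symm_apply_apply, Sum.map_inl]
      exact barIdx_mem_dbl.2 (Finset.orderEmbOfFin_mem T rfl i)
    · simp only [E, Equiv.symm_apply_apply, Sum.map_inr]
      exact psiIdx_mem_dbl.2 (Finset.orderEmbOfFin_mem T rfl i)
  have hEeq : E = (dbl T).orderEmbOfFin (card_dbl T) := Finset.orderEmbOfFin_unique (card_dbl T) hEmem hE
  rw [grassmannBasis_eq_prod_map_gen, ← Finset.listMap_orderEmbOfFin_finRange _ (card_dbl T), ← hEeq,
    List.map_map, ← List.ofFn_eq_map, prod_ofFn_add_eq, pairProd_eq_list_prod, sort_eq_ofFn_orderEmbOfFin,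
    List.map_ofFn]
  have key := prod_psiBar_mul_prod_psi ℂ (fun i : Fin T.card => e i) (fun i => e i)
  simp only [Function.comp_apply, E, Equiv.symm_apply_apply, Sum.map_inl, Sum.map_inr]
  exact key

/-- A pair product is `ε_{|T|}` times the doubled basis monomial. [cite: Berezin1966, Ch. I §3 (3.3)] -/
theorem pairProd_eq_sgn_smul (T : Finset ι) :
    pairProd T = sgn T.card • grassmannBasis ℂ (ι ⊕ₗ ι) (dbl T) := by
  rw [grassmannBasis_dbl, smul_smul, sgn, ← pow_add, ← two_mul, pow_mul, neg_one_sq, one_pow, one_smul]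

/-- **Berezin integral of a pair product**: `∫dψ̄dψ ∏_{i∈T} ψ̄_iψ_i = ε_{|ι|} [T = everything]`
(only the full product has top degree). [cite: Berezin1966, Ch. I §3 (3.4)–(3.5)] -/
theorem berezin_pairProd (T : Finset ι) :
    berezin ℂ _ (pairProd T) = if T = Finset.univ then sgn (Fintype.card ι) else 0 := by
  rw [pairProd_eq_sgn_smul, map_smul, smul_eq_mul]
  by_cases hT : T = Finset.univ
  · subst hT
    rw [if_pos rfl, dbl_univ, berezin_grassmannBasis_univ, mul_one, Finset.card_univ]
  · rw [if_neg hT, berezin_grassmannBasis_of_ne, mul_zero]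
    exact fun h => hT (dbl_eq_univ_iff.1 h)

/-- **Berezin integral of the full pair product**: `∫dψ̄dψ ∏_{i} ψ̄_iψ_i = ε_{|ι|}`. [cite: Berezin1966, Ch. I §3 (3.4)–(3.5)] -/
theorem berezin_pairProd_univ : berezin ℂ _ (pairProd (Finset.univ : Finset ι)) = sgn (Fintype.card ι) := by
  rw [berezin_pairProd, if_pos rfl]

/-- **Expansion of an element supported on doubled monomials.** If every coordinate of `a` on a
non-doubled monomial vanishes, `a = ∑_T a_{dbl T} θ_{dbl T}`. [cite: Berezin1966, Ch. I §3 (3.3)] -/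
theorem eq_sum_coord_dbl {a : GrassmannAlgebra ℂ (ι ⊕ₗ ι)}
    (ha : ∀ S : Finset (ι ⊕ₗ ι), ¬IsDoubled S → coord S a = 0) :
    a = ∑ T : Finset ι, coord (dbl T) a • grassmannBasis ℂ (ι ⊕ₗ ι) (dbl T) := by
  refine ext_coord fun S => ?_
  simp only [coord_sum, coord_smul, coord_basis, mul_ite, mul_one, mul_zero]
  by_cases hS : IsDoubled S
  · rw [Finset.sum_eq_single (barPart S)]
    · rw [if_pos (dbl_barPart hS), dbl_barPart hS]
    · intro T _ hT
      rw [if_neg]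
      intro h
      exact hT (dbl_injective (h.trans (dbl_barPart hS).symm))
    · intro h; exact absurd (Finset.mem_univ _) h
  · rw [ha S hS, Finset.sum_eq_zero]
    intro T _
    rw [if_neg]
    rintro rfl
    exact hS (isDoubled_dbl T)

/-! ### Substitutions of the generators -/

/-- The scaling substitution `ψ̄_i ↦ c(ψ̄_i) ψ̄_i`, `ψ_i ↦ c(ψ_i) ψ_i`. [cite: Berezin1966, Ch. I §3] -/
abbrev scale (c : ι ⊕ₗ ι → ℂ) : GrassmannAlgebra ℂ (ι ⊕ₗ ι) →ₐ[ℂ] GrassmannAlgebra ℂ (ι ⊕ₗ ι) :=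
  ExteriorAlgebra.map (LinearMap.mulLeft ℂ c)

omit [Fintype ι] in
/-- Scaling `ψ̄_i`. [cite: Berezin1966, Ch. I §3] -/
theorem scale_psiBar (c : ι ⊕ₗ ι → ℂ) (i : ι) : scale c (psiBar ℂ i) = c (barIdx i) • psiBar ℂ i :=
  map_mulLeft_gen ℂ c _

omit [Fintype ι] in
/-- Scaling `ψ_i`. [cite: Berezin1966, Ch. I §3] -/
theorem scale_psi (c : ι ⊕ₗ ι → ℂ) (i : ι) : scale c (psi ℂ i) = c (psiIdx i) • psi ℂ i :=
  map_mulLeft_gen ℂ c _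

omit [Fintype ι] in
/-- Scaling a pair. [cite: Berezin1966, Ch. I §3] -/
theorem scale_pair (c : ι ⊕ₗ ι → ℂ) (i j : ι) :
    scale c (pair i j) = (c (barIdx i) * c (psiIdx j)) • pair i j := by
  rw [map_mul, scale_psiBar, scale_psi, smul_mul_smul_comm]

omit [LinearOrder ι] in
/-- Scaling commutes with the exponential. [cite: Berezin1966, Ch. I §3] -/
theorem scale_grassmannExp (c : ι ⊕ₗ ι → ℂ) (a : GrassmannAlgebra ℂ (ι ⊕ₗ ι)) :
    scale c (grassmannExp a) = grassmannExp (scale c a) := map_grassmannExp_eq ℂ _ a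

omit [Fintype ι] in
/-- The relabelling of the generator indices along a permutation `τ` of `ι` (acting the same way on
`ψ̄_i` and `ψ_i`). [cite: Berezin1966, Ch. I §3] -/
def relabelEquiv (τ : Equiv.Perm ι) : (ι ⊕ₗ ι) ≃ (ι ⊕ₗ ι) :=
  toLex.symm.trans ((Equiv.sumCongr τ τ).trans toLex)

/-- The relabelling automorphism of the Grassmann algebra along a permutation of the indices. [cite: Berezin1966, Ch. I §3] -/
abbrev relabel (τ : Equiv.Perm ι) : GrassmannAlgebra ℂ (ι ⊕ₗ ι) →ₐ[ℂ] GrassmannAlgebra ℂ (ι ⊕ₗ ι) :=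
  ExteriorAlgebra.map (LinearMap.funLeft ℂ ℂ (relabelEquiv τ).symm)

omit [Fintype ι] in
/-- Relabelling `ψ̄_i`. [cite: Berezin1966, Ch. I §3] -/
theorem relabel_psiBar (τ : Equiv.Perm ι) (i : ι) : relabel τ (psiBar ℂ i) = psiBar ℂ (τ i) := by
  rw [psiBar, relabel, map_funLeft_gen]; rfl

omit [Fintype ι] in
/-- Relabelling `ψ_i`. [cite: Berezin1966, Ch. I §3] -/
theorem relabel_psi (τ : Equiv.Perm ι) (i : ι) : relabel τ (psi ℂ i) = psi ℂ (τ i) := by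
  rw [psi, relabel, map_funLeft_gen]; rfl

omit [Fintype ι] in
/-- Relabelling a pair. [cite: Berezin1966, Ch. I §3] -/
theorem relabel_pair (τ : Equiv.Perm ι) (i j : ι) : relabel τ (pair i j) = pair (τ i) (τ j) := by
  rw [map_mul, relabel_psiBar, relabel_psi]

omit [LinearOrder ι] [Fintype ι] in
/-- Relabelling commutes with the exponential. [cite: Berezin1966, Ch. I §3] -/
theorem relabel_grassmannExp (τ : Equiv.Perm ι) (a : GrassmannAlgebra ℂ (ι ⊕ₗ ι)) :
    relabel τ (grassmannExp a) = grassmannExp (relabel τ a) := map_funLeft_grassmannExp ℂ _ a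

omit [Fintype ι] in
/-- Relabelling a pair product. [cite: Berezin1966, Ch. I §3] -/
theorem relabel_pairProd (τ : Equiv.Perm ι) (T : Finset ι) :
    relabel τ (pairProd T) = pairProd (T.map τ.toEmbedding) := by
  induction T using Finset.induction_on with
  | empty => simp
  | insert a T ha ih =>
    rw [pairProd_insert ha, map_mul, ih, relabel_pair, Finset.map_insert, pairProd_insert]
    · rfl
    · simpa using ha

/-- Relabelling a doubled monomial: no sign. [cite: Berezin1966, Ch. I §3 (3.3)] -/
theorem relabel_grassmannBasis_dbl (τ : Equiv.Perm ι) (T : Finset ι) :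
    relabel τ (grassmannBasis ℂ (ι ⊕ₗ ι) (dbl T)) = grassmannBasis ℂ (ι ⊕ₗ ι) (dbl (T.map τ.toEmbedding)) := by
  rw [grassmannBasis_dbl, map_smul, relabel_pairProd, grassmannBasis_dbl, Finset.card_map]

/-- **Permutation symmetry of doubled coefficients.** If `a` is supported on doubled monomials and
fixed by the relabelling `τ`, its coefficients are `τ`-invariant: `a_{dbl (τ T)} = a_{dbl T}`. [cite: Berezin1966, Ch. I §3 (3.3)] -/
theorem coord_dbl_map_eq_of_relabel_eq {a : GrassmannAlgebra ℂ (ι ⊕ₗ ι)}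
    (ha : ∀ S : Finset (ι ⊕ₗ ι), ¬IsDoubled S → coord S a = 0) {τ : Equiv.Perm ι} (h : relabel τ a = a)
    (T : Finset ι) : coord (dbl (T.map τ.toEmbedding)) a = coord (dbl T) a := by
  have hexp := eq_sum_coord_dbl ha
  have h1 : relabel τ a = ∑ T : Finset ι, coord (dbl T) a • grassmannBasis ℂ _ (dbl (T.map τ.toEmbedding)) := by
    conv_lhs => rw [hexp]
    simp only [map_sum, map_smul, relabel_grassmannBasis_dbl]
  rw [h] at h1
  conv_lhs => rw [h1]
  simp only [coord_sum, coord_smul, coord_basis, mul_ite, mul_one, mul_zero]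
  rw [Finset.sum_eq_single T, if_pos rfl]
  · intro T' _ hT'
    rw [if_neg]
    intro hEq
    exact hT' (Finset.map_injective τ.toEmbedding (dbl_injective hEq))
  · intro hT; exact absurd (Finset.mem_univ T) hT

/-! ### The quadratic form `ψ̄Aψ` -/

/-- `ψ̄(A+B)ψ = ψ̄Aψ + ψ̄Bψ`. [cite: Berezin1966, Ch. I §3 Thm. 3.1] -/
theorem quadratic_add (A B : Matrix ι ι ℂ) : quadratic ℂ (A + B) = quadratic ℂ A + quadratic ℂ B := by
  simp [quadratic, add_smul, Finset.sum_add_distrib]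

/-- `ψ̄(cA)ψ = c ψ̄Aψ`. [cite: Berezin1966, Ch. I §3 Thm. 3.1] -/
theorem quadratic_smul (c : ℂ) (A : Matrix ι ι ℂ) : quadratic ℂ (c • A) = c • quadratic ℂ A := by
  simp [quadratic, Finset.smul_sum, smul_smul]

/-- `ψ̄Aψ = ∑_{ij} A_{ij} ψ̄_iψ_j`. [cite: Berezin1966, Ch. I §3 Thm. 3.1] -/
theorem quadratic_eq_sum_pair (A : Matrix ι ι ℂ) : quadratic ℂ A = ∑ i, ∑ j, A i j • pair i j := rfl

/-- A diagonal quadratic form is a weighted sum of pairs. [cite: Berezin1966, Ch. I §3 Thm. 3.1] -/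
theorem quadratic_diagonal (d : ι → ℂ) : quadratic ℂ (Matrix.diagonal d) = ∑ i, d i • pair i i := by
  simp only [quadratic_eq_sum_pair, Matrix.diagonal_apply, ite_smul, zero_smul, Finset.sum_ite_eq,
    Finset.mem_univ, if_true]

/-- `ψ̄Aψ` is central. [cite: Berezin1966, Ch. I §3 (3.1)] -/
theorem commute_quadratic (A : Matrix ι ι ℂ) (z : GrassmannAlgebra ℂ (ι ⊕ₗ ι)) : Commute (quadratic ℂ A) z :=
  commute_of_mem_evenOdd_zero ℂ (quadratic_mem_evenOdd_zero ℂ A) z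

/-- `ψ̄Aψ` has no constant term. [cite: Berezin1966, Ch. I §3 (3.1)] -/
theorem constPart_quadratic (A : Matrix ι ι ℂ) : constPart ℂ (quadratic ℂ A) = 0 := by
  simp [quadratic, psiBar, psi]

/-- Uniform nilpotency bound: `(c • ψ̄Aψ)^(|generators|+1) = 0`. [cite: Berezin1966, Ch. I §3 (3.1)] -/
theorem smul_quadratic_pow_eq_zero (c : ℂ) (A : Matrix ι ι ℂ) :
    (c • quadratic ℂ A) ^ (Fintype.card (ι ⊕ₗ ι) + 1) = 0 :=
  pow_card_succ_eq_zero_of_constPart_eq_zero ℂ (by rw [map_smul, constPart_quadratic, smul_zero])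

/-- `c • ψ̄Aψ` is nilpotent. [cite: Berezin1966, Ch. I §3 (3.1)] -/
theorem isNilpotent_smul_quadratic (c : ℂ) (A : Matrix ι ι ℂ) : IsNilpotent (c • quadratic ℂ A) :=
  ⟨_, smul_quadratic_pow_eq_zero c A⟩

/-- `c • ψ̄Aψ` is even. [cite: Berezin1966, Ch. I §3 (3.1)] -/
theorem smul_quadratic_mem_evenOdd_zero (c : ℂ) (A : Matrix ι ι ℂ) :
    c • quadratic ℂ A ∈ evenOdd ℂ (ι := ι ⊕ₗ ι) 0 :=
  Submodule.smul_mem _ c (quadratic_mem_evenOdd_zero ℂ A)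

/-- `exp(c • ψ̄Aψ)` is even. [cite: Berezin1966, Ch. I §3 Thm. 3.1] -/
theorem grassmannExp_smul_quadratic_mem_evenOdd_zero (c : ℂ) (A : Matrix ι ι ℂ) :
    grassmannExp (c • quadratic ℂ A) ∈ evenOdd ℂ (ι := ι ⊕ₗ ι) 0 :=
  grassmannExp_mem_evenOdd_zero ℂ (smul_quadratic_mem_evenOdd_zero c A) (isNilpotent_smul_quadratic c A)

/-- `exp(c • ψ̄Aψ)` is central. [cite: Berezin1966, Ch. I §3 Thm. 3.1] -/
theorem commute_grassmannExp_smul_quadratic (c : ℂ) (A : Matrix ι ι ℂ) (z : GrassmannAlgebra ℂ (ι ⊕ₗ ι)) :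
    Commute (grassmannExp (c • quadratic ℂ A)) z :=
  commute_of_mem_evenOdd_zero ℂ (grassmannExp_smul_quadratic_mem_evenOdd_zero c A) z

end Doubled

end GrassmannAlgebra

end Literature.MathematicalPhysics.QuantumLattice
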